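import Summits.QuantumFields.YangMills.Theorems.AtomicSynthesisMolliTaylorLine
import Summits.QuantumFields.YangMills.Theorems.AtomicSynthesisMomentKilling
import Literature.Analysis.Approximation.PolynomialCkDensity
import Mathlib
import HarnessLib

/-!
# Mollification with vanishing moments: `‖D^m(K_τ ⋆ f − f)‖ ≤ 2 M(K) τ^{N−m} sup ‖D^N f‖`
# (def-free core of H4a `MolliApprox` of the registered stub `stub_singleSlot`, AtomicSynthesis ⟨stmt-QuantumFields-28126⟩,
# path α of the lines on 23138 / 22956; planner ym-idea-11 g14 reduction `g14/oneStepSplit.lean`)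

For a continuous compactly supported kernel `K : ℝ⁴ → ℝ` with `∫ K = 1` and vanishing monomial moments of orders `1 … N−1`, its
scalings `K_τ(w) = τ⁻⁴ K(τ⁻¹ w)` (`τ > 0`) and a smooth `g`:

* `integral_smul_multilinear_diag_eq_zero` — VECTOR-valued moment lemma: `∫ K(v) • Φ(v,…,v) dv = 0` for every continuous `k`-linear
  `Φ` with values in a normed space, `1 ≤ k < N` (adapted from planner ym-idea-11 g14's `g14/molliHelpers.lean`, scalar case);
* `convolution_scaled_eq` — `(K_τ ⋆ g)(x) = ∫ K(v) • g(x − τv) dv`;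
* ★ `norm_convolution_scaled_sub_self_le` — ORDER ZERO: if `‖D^n g‖ ≤ B` (`n ≤ N`) then `‖(K_τ ⋆ g)(x) − g(x)‖ ≤ 2 M(K) τ^n B`,
  `M(K) = ∫ |K(v)| (1 + ‖v‖)^N dv` (Taylor along the line `t ↦ g(x − tv)`, ✓`AtomicSynthesisMolli.norm_sub_taylor_line_le`; the Taylor
  terms of orders `1 … n−1` die against the moments);
* ★ `norm_iteratedFDeriv_convolution_scaled_sub_self_le` — ALL ORDERS by Leibniz' rule (tree
  `Literature.Analysis.Approximation.fderiv_convolution_sub_self`, induction with universe-polymorphic codomain as in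
  `exists_forall_norm_iteratedFDeriv_convolution_sub_self_le`): `‖D^m(K_τ ⋆ g − g)(x)‖ ≤ 2 M(K) τ^n B` if `‖D^{n+m} g‖ ≤ B`;
* ★ `molliApprox_core` — the statement of `MolliApprox` with `kSmooth`/`combKernel` unfolded, for ANY such kernel:
  `‖D^m(f − K_τ ⋆ f)(z)‖ ≤ 2M(K) (τ/σ)^N A/τ^m` for `m ≤ N` when `‖D^m f‖ ≤ A/σ^m` (`m ≤ N`), `0 < τ ≤ σ`.

THEOREMS ONLY; Mathlib + tree; no `sorry`; standard axioms.  HONEST FRAMING: folklore approximation theory serving a registered L stub of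
lines on the RECORD-label R-floor cruxes 23138/22956; nothing here touches Yang–Mills; the YM mass gap is NOT proved.  Width seat
`ym-line-sfw-p2-w3` g36 (cell ym-idea-1, free hands), `--supports stmt-QuantumFields-28126`. [folklore]
-/

set_option autoImplicit false

noncomputable section

open scoped BigOperators ContDiff Topology Nat Convolution
open Set MeasureTheory ContinuousLinearMap Metric
open Literature.Analysis.Approximation (fderiv_convolution_sub_self)

namespace Summit.QuantumFields.YangMills.Theorems.AtomicSynthesisMolli

universe u

open Summit.QuantumFields.YangMills.Cruxes.AtomicSynthesis.SingleSlotPlan (E4)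

section Moments

variable {F : Type*} [NormedAddCommGroup F] [NormedSpace ℝ F]

/-- A word `r : Fin k → Fin 4` evaluates the product of coordinates to the monomial with exponents `#{j | r j = i}`
(planner ym-idea-11 g14, `molliHelpers.prod_word_eq_monomial`). -/
theorem prod_word_eq_monomial {k : ℕ} (r : Fin k → Fin 4) (v : E4) :
    ∏ j, v (r j) = ∏ i, (v i) ^ ((Finset.univ.filter fun j => r j = i).card) := by
  rw [← Finset.prod_fiberwise Finset.univ r (fun j => v (r j))]
  refine Finset.prod_congr rfl fun i _ => ?_
  rw [Finset.prod_congr rfl (fun j hj => by rw [(Finset.mem_filter.1 hj).2]), Finset.prod_const]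

/-- The exponents of a word of length `k` add up to `k`. -/
theorem sum_card_filter_eq {k : ℕ} (r : Fin k → Fin 4) : ∑ i, (Finset.univ.filter fun j => r j = i).card = k := by
  rw [← Finset.card_eq_sum_card_fiberwise (s := Finset.univ) (t := Finset.univ) (fun _ _ => Finset.mem_univ _)]
  simp

/-- A continuous `k`-linear map on the diagonal is a combination of monomials of degree `k` with vector coefficients
(vector-valued version of planner ym-idea-11 g14's `multilinear_diag_expand`). -/
theorem multilinear_diag_expand {k : ℕ} (Φ : ContinuousMultilinearMap ℝ (fun _ : Fin k => E4) F) (v : E4) :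
    Φ (fun _ => v) = ∑ r : Fin k → Fin 4,
      (∏ i, (v i) ^ ((Finset.univ.filter fun j => r j = i).card)) • Φ (fun j => EuclideanSpace.single (r j) (1 : ℝ)) := by
  classical
  have hv : (fun _ : Fin k => v) = fun _ : Fin k => ∑ i : Fin 4, (v i) • EuclideanSpace.single i (1 : ℝ) := by
    funext j
    have := (EuclideanSpace.basisFun (Fin 4) ℝ).sum_repr v
    simp_rw [EuclideanSpace.basisFun_repr, EuclideanSpace.basisFun_apply] at this
    exact this.symm
  rw [hv, Φ.map_sum (fun (_ : Fin k) (i : Fin 4) => (v i) • EuclideanSpace.single i (1 : ℝ))]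
  refine Finset.sum_congr rfl fun r _ => ?_
  rw [Φ.map_smul_univ (fun j => v (r j)) (fun j => EuclideanSpace.single (r j) (1 : ℝ)), prod_word_eq_monomial]

/-- ★ **Vector-valued moment lemma.**  If the monomial moments of orders `1 ≤ |α| < N` of a continuous compactly supported `K`
vanish, then `∫ K(v) • Φ(v,…,v) dv = 0` for every continuous `k`-linear `Φ` with values in a normed space, `1 ≤ k < N`. -/
theorem integral_smul_multilinear_diag_eq_zero [CompleteSpace F] (K : E4 → ℝ) (hKc : Continuous K) (hK : HasCompactSupport K)
    {k N : ℕ} (hk1 : 1 ≤ k) (hkN : k < N)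
    (hmom : ∀ α : Fin 4 → ℕ, 1 ≤ ∑ i, α i → ∑ i, α i < N → ∫ y, K y * ∏ i, (y i) ^ (α i) = 0)
    (Φ : ContinuousMultilinearMap ℝ (fun _ : Fin k => E4) F) :
    ∫ v, K v • Φ (fun _ => v) = 0 := by
  classical
  simp_rw [multilinear_diag_expand Φ, Finset.smul_sum, ← smul_assoc, smul_eq_mul]
  rw [integral_finsetSum]
  · refine Finset.sum_eq_zero fun r _ => ?_
    rw [integral_smul_const, hmom _ (by rw [sum_card_filter_eq]; exact hk1) (by rw [sum_card_filter_eq]; exact hkN), zero_smul]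
  · intro r _
    refine Integrable.smul_const ?_ _
    have hc : Continuous fun y : E4 => K y * ∏ i, (y i) ^ ((Finset.univ.filter fun j => r j = i).card) := hKc.mul (by fun_prop)
    exact hc.integrable_of_hasCompactSupport hK.mul_right

end Moments

section Core

variable {F : Type*} [NormedAddCommGroup F] [NormedSpace ℝ F] [CompleteSpace F]

/-- The scaled kernel `w ↦ τ⁻⁴ K(τ⁻¹ w)` is continuous. -/
theorem continuous_scaled {K : E4 → ℝ} (hKc : Continuous K) (τ : ℝ) : Continuous fun w : E4 => (τ ^ 4)⁻¹ * K (τ⁻¹ • w) :=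
  continuous_const.mul (hKc.comp (continuous_id.const_smul τ⁻¹))

omit [CompleteSpace F] in
/-- **The scaled convolution as an integral against `K`**: `(K_τ ⋆ g)(x) = ∫ K(v) • g(x − τ v) dv` (`τ > 0`). -/
theorem convolution_scaled_eq (K : E4 → ℝ) (g : E4 → F) {τ : ℝ} (hτ : 0 < τ) (x : E4) :
    ((fun w : E4 => (τ ^ 4)⁻¹ * K (τ⁻¹ • w)) ⋆[lsmul ℝ ℝ, volume] g) x = ∫ v, K v • g (x - τ • v) := by
  rw [convolution_def]
  simp only [lsmul_apply]
  have hsub := Measure.integral_comp_smul volume (fun t : E4 => ((τ ^ 4)⁻¹ * K (τ⁻¹ • t)) • g (x - t)) τ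
  have h4 : Module.finrank ℝ E4 = 4 := by simp
  simp only [h4, smul_smul, inv_mul_cancel₀ hτ.ne', one_smul] at hsub
  have hτ4 : 0 < τ ^ 4 := by positivity
  rw [abs_of_pos (inv_pos.2 hτ4)] at hsub
  -- `hsub : ∫ v, (τ⁴)⁻¹ K v • g(x − τv) = (τ⁴)⁻¹ • ∫ t, (τ⁴)⁻¹ K(τ⁻¹t) • g(x − t)`
  have h2 : ∫ v : E4, ((τ ^ 4)⁻¹ * K v) • g (x - τ • v) = (τ ^ 4)⁻¹ • ∫ v : E4, K v • g (x - τ • v) := by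
    rw [← integral_smul]; congr 1; funext v; rw [mul_smul]
  rw [h2] at hsub
  have := congrArg (fun w : F => (τ ^ 4) • w) hsub
  simp only [smul_smul, mul_inv_cancel₀ hτ4.ne', one_smul] at this
  exact this.symm

omit [CompleteSpace F] in
/-- Integrability of `v ↦ K(v) • G(v)` for `K` continuous with compact support and `G` continuous. -/
theorem integrable_smul_of_continuous {K : E4 → ℝ} (hKc : Continuous K) (hK : HasCompactSupport K) {G : E4 → F}
    (hG : Continuous G) : Integrable (fun v : E4 => K v • G v) :=
  (hKc.smul hG).integrable_of_hasCompactSupport hK.smul_right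

/-- ★ **Order zero.**  For a continuous compactly supported kernel with `∫ K = 1` and vanishing monomial moments of orders `1 … N−1`,
a smooth `g` with `‖D^n g‖ ≤ B` everywhere (`n ≤ N`) and `τ > 0`:
`‖(K_τ ⋆ g)(x) − g(x)‖ ≤ 2 · (∫ |K(v)| (1+‖v‖)^N dv) · τ^n · B`. [folklore] -/
theorem norm_convolution_scaled_sub_self_le (K : E4 → ℝ) (hKc : Continuous K) (hK : HasCompactSupport K)
    (hK1 : ∫ v, K v = 1) {N : ℕ}
    (hmom : ∀ α : Fin 4 → ℕ, 1 ≤ ∑ i, α i → ∑ i, α i < N → ∫ y, K y * ∏ i, (y i) ^ (α i) = 0)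
    {g : E4 → F} (hg : ContDiff ℝ ∞ g) {n : ℕ} (hn : n ≤ N) {B : ℝ} (hB : ∀ z, ‖iteratedFDeriv ℝ n g z‖ ≤ B)
    {τ : ℝ} (hτ : 0 < τ) (x : E4) :
    ‖((fun w : E4 => (τ ^ 4)⁻¹ * K (τ⁻¹ • w)) ⋆[lsmul ℝ ℝ, volume] g) x - g x‖ ≤
      2 * (∫ v, |K v| * (1 + ‖v‖) ^ N) * τ ^ n * B := by
  have hB0 : 0 ≤ B := (norm_nonneg _).trans (hB x)
  set M : ℝ := ∫ v, |K v| * (1 + ‖v‖) ^ N with hM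
  have hM0 : 0 ≤ M := integral_nonneg fun v => by positivity
  have hMint : Integrable fun v : E4 => |K v| * (1 + ‖v‖) ^ N :=
    (hKc.abs.mul (by fun_prop)).integrable_of_hasCompactSupport hK.abs.mul_right
  have hgc : Continuous g := hg.continuous
  have hgl : Continuous fun v : E4 => g (x - τ • v) := hgc.comp (continuous_const.sub (continuous_id.const_smul τ))
  -- `g x = ∫ K v • g x`
  have hgx : ∫ v : E4, K v • g x = g x := by rw [integral_smul_const, hK1, one_smul]
  rw [convolution_scaled_eq K g hτ x]
  -- pointwise weight `|K v| ‖v‖^n ≤ |K v| (1+‖v‖)^N`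
  have hpow : ∀ v : E4, ‖v‖ ^ n ≤ (1 + ‖v‖) ^ N := fun v =>
    (pow_le_pow_left₀ (norm_nonneg v) (by linarith [norm_nonneg v]) n).trans
      (pow_le_pow_right₀ (by linarith [norm_nonneg v]) hn)
  rcases Nat.eq_zero_or_pos n with rfl | hnpos
  · -- `n = 0`: `‖g‖ ≤ B`
    have hB' : ∀ z, ‖g z‖ ≤ B := fun z => by rw [← norm_iteratedFDeriv_zero (𝕜 := ℝ)]; exact hB z
    rw [← hgx, ← integral_sub (integrable_smul_of_continuous hKc hK hgl) (integrable_smul_of_continuous hKc hK continuous_const)]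
    simp_rw [← smul_sub]
    calc ‖∫ v : E4, K v • (g (x - τ • v) - g x)‖ ≤ ∫ v : E4, |K v| * (1 + ‖v‖) ^ N * (2 * B) := by
          refine norm_integral_le_of_norm_le (hMint.mul_const _) (ae_of_all _ fun v => ?_)
          rw [norm_smul, Real.norm_eq_abs]
          have h1 : ‖g (x - τ • v) - g x‖ ≤ 2 * B := (norm_sub_le _ _).trans (by linarith [hB' (x - τ • v), hB' x])
          have h2 : |K v| ≤ |K v| * (1 + ‖v‖) ^ N :=
            le_mul_of_one_le_right (abs_nonneg _) (one_le_pow₀ (by linarith [norm_nonneg v]))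
          exact mul_le_mul h2 h1 (norm_nonneg _) (by positivity)
      _ = 2 * M * τ ^ 0 * B := by rw [integral_mul_const, pow_zero]; ring
  · -- `n = n' + 1`: Taylor along the line `t ↦ g(x + t(−v))`
    obtain ⟨n', rfl⟩ : ∃ n', n = n' + 1 := ⟨n - 1, by omega⟩
    -- the Taylor sum, as a function of `v`
    set S : E4 → F := fun v => ∑ j ∈ Finset.range (n' + 1),
      ((j ! : ℝ)⁻¹ * τ ^ j) • iteratedFDeriv ℝ j g x (fun _ => -v) with hS
    have hSc : Continuous S := by
      refine continuous_finsetSum _ fun j _ => ?_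
      exact ((iteratedFDeriv ℝ j g x).cont.comp (continuous_pi fun _ => continuous_neg)).const_smul _
    -- `∫ K • S = g x`: the `j = 0` term gives `g x`, the others vanish by the moment lemma
    have hdiag : ∀ (j : ℕ) (v : E4), iteratedFDeriv ℝ j g x (fun _ => -v) = ((-1 : ℝ) ^ j) • iteratedFDeriv ℝ j g x (fun _ => v) := by
      intro j v
      have := (iteratedFDeriv ℝ j g x).map_smul_univ (fun _ => (-1 : ℝ)) (fun _ => v)
      simpa [Finset.prod_const, Finset.card_fin] using this
    have hSint : ∫ v : E4, K v • S v = g x := by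
      have hterm : ∀ j ∈ Finset.range (n' + 1), Integrable (fun v : E4 =>
          K v • (((j ! : ℝ)⁻¹ * τ ^ j) • iteratedFDeriv ℝ j g x (fun _ => -v))) := fun j _ =>
        integrable_smul_of_continuous hKc hK
          (((iteratedFDeriv ℝ j g x).cont.comp (continuous_pi fun _ => continuous_neg)).const_smul _)
      simp only [hS, Finset.smul_sum]
      rw [integral_finsetSum _ hterm, Finset.sum_range_succ']
      have h0 : ∫ v : E4, K v • (((0 ! : ℝ)⁻¹ * τ ^ 0) • iteratedFDeriv ℝ 0 g x (fun _ => -v)) = g x := by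
        simp only [Nat.factorial_zero, Nat.cast_one, inv_one, pow_zero, mul_one, one_smul, iteratedFDeriv_zero_apply]
        exact hgx
      rw [h0, add_eq_right]
      refine Finset.sum_eq_zero fun j hj => ?_
      have hj' : j + 1 < N := by have := Finset.mem_range.1 hj; omega
      simp_rw [hdiag (j + 1), smul_smul]
      have : ∀ v : E4, (K v * ((((j + 1) ! : ℝ))⁻¹ * τ ^ (j + 1) * (-1) ^ (j + 1))) • iteratedFDeriv ℝ (j + 1) g x (fun _ => v) =
          ((((j + 1) ! : ℝ))⁻¹ * τ ^ (j + 1) * (-1) ^ (j + 1)) • (K v • iteratedFDeriv ℝ (j + 1) g x (fun _ => v)) := by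
        intro v; rw [smul_smul]; ring_nf
      simp_rw [this]
      rw [integral_smul, integral_smul_multilinear_diag_eq_zero K hKc hK (by omega) hj' hmom, smul_zero]
    -- the remainder, pointwise
    have hrem : ∀ v : E4, ‖g (x - τ • v) - S v‖ ≤ B * ‖v‖ ^ (n' + 1) * τ ^ (n' + 1) / n' ! := by
      intro v
      have h := norm_sub_taylor_line_le hg x (-v) hτ n' hB
      rw [norm_neg, show x + τ • -v = x - τ • v by rw [smul_neg, sub_eq_add_neg]] at h
      exact h
    -- assemble
    have hI1 : Integrable (fun v : E4 => K v • g (x - τ • v)) := integrable_smul_of_continuous hKc hK hgl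
    have hI2 : Integrable (fun v : E4 => K v • S v) := integrable_smul_of_continuous hKc hK hSc
    rw [← hSint, ← integral_sub hI1 hI2]
    simp_rw [← smul_sub]
    have hfac : ((n' ! : ℝ))⁻¹ ≤ 1 := inv_le_one_of_one_le₀ (by exact_mod_cast Nat.one_le_iff_ne_zero.2 (Nat.factorial_ne_zero n'))
    calc ‖∫ v : E4, K v • (g (x - τ • v) - S v)‖
        ≤ ∫ v : E4, |K v| * (1 + ‖v‖) ^ N * (B * τ ^ (n' + 1)) := by
          refine norm_integral_le_of_norm_le (hMint.mul_const _) (ae_of_all _ fun v => ?_)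
          rw [norm_smul, Real.norm_eq_abs]
          calc |K v| * ‖g (x - τ • v) - S v‖ ≤ |K v| * (B * ‖v‖ ^ (n' + 1) * τ ^ (n' + 1) / n' !) :=
                mul_le_mul_of_nonneg_left (hrem v) (abs_nonneg _)
            _ = |K v| * ‖v‖ ^ (n' + 1) * (B * τ ^ (n' + 1)) * ((n' ! : ℝ))⁻¹ := by rw [div_eq_mul_inv]; ring
            _ ≤ |K v| * (1 + ‖v‖) ^ N * (B * τ ^ (n' + 1)) * 1 := by
                refine mul_le_mul ?_ hfac (by positivity) (by positivity)
                exact mul_le_mul_of_nonneg_right (mul_le_mul_of_nonneg_left (hpow v) (abs_nonneg _)) (by positivity)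
            _ = |K v| * (1 + ‖v‖) ^ N * (B * τ ^ (n' + 1)) := mul_one _
      _ = M * (B * τ ^ (n' + 1)) := by rw [integral_mul_const]
      _ ≤ 2 * M * τ ^ (n' + 1) * B := by nlinarith [mul_nonneg hM0 (mul_nonneg hB0 (pow_pos hτ (n' + 1)).le)]

/-- ★ **All orders (Leibniz' rule).**  For a continuous compactly supported kernel with `∫ K = 1` and vanishing monomial moments of
orders `1 … N−1`, a smooth compactly supported `g` with values in a complete normed space, `n ≤ N`, `‖D^{n+m} g‖ ≤ B` everywhere and
`τ > 0`: `‖D^m(K_τ ⋆ g − g)(x)‖ ≤ 2 (∫ |K(v)| (1+‖v‖)^N dv) τ^n B` — induction on `m` moving one derivative onto `g`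
(tree `fderiv_convolution_sub_self`), the codomain running through `F, ℝ⁴ →L F, …` (universe-polymorphic statement). [folklore] -/
theorem norm_iteratedFDeriv_convolution_scaled_sub_self_le (K : E4 → ℝ) (hKc : Continuous K) (hK : HasCompactSupport K)
    (hK1 : ∫ v, K v = 1) {N : ℕ}
    (hmom : ∀ α : Fin 4 → ℕ, 1 ≤ ∑ i, α i → ∑ i, α i < N → ∫ y, K y * ∏ i, (y i) ^ (α i) = 0)
    {τ : ℝ} (hτ : 0 < τ) (m : ℕ) :
    ∀ {F' : Type u} [NormedAddCommGroup F'] [NormedSpace ℝ F'] [CompleteSpace F'] {g : E4 → F'},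
      ContDiff ℝ ∞ g → HasCompactSupport g → ∀ {n : ℕ} {B : ℝ}, n ≤ N → (∀ z, ‖iteratedFDeriv ℝ (n + m) g z‖ ≤ B) →
      ∀ x, ‖iteratedFDeriv ℝ m ((fun w : E4 => (τ ^ 4)⁻¹ * K (τ⁻¹ • w)) ⋆[lsmul ℝ ℝ, volume] g - g) x‖ ≤
        2 * (∫ v, |K v| * (1 + ‖v‖) ^ N) * τ ^ n * B := by
  induction m with
  | zero =>
    intro F' _ _ _ g hg _ n B hn hB x
    rw [norm_iteratedFDeriv_zero]
    exact norm_convolution_scaled_sub_self_le K hKc hK hK1 hmom hg hn hB hτ x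
  | succ m ih =>
    intro F' _ _ _ g hg hgc n B hn hB x
    have hg1 : ContDiff ℝ 1 g := hg.of_le (by exact_mod_cast le_top)
    rw [← norm_iteratedFDeriv_fderiv, fderiv_convolution_sub_self (continuous_scaled hKc τ) hg1 hgc]
    refine ih (contDiff_infty_iff_fderiv.1 hg).2 (hgc.fderiv ℝ) hn (fun z => ?_) x
    rw [norm_iteratedFDeriv_fderiv]
    exact hB z

/-- The scaled convolution, written out: `(K_τ ⋆ f)(x) = ∫ τ⁻⁴ K(τ⁻¹(x − y)) f(y) dy` (the skeleton's `kSmooth K τ f x`). -/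
theorem convolution_scaled_apply (K f : E4 → ℝ) (τ : ℝ) (x : E4) :
    ((fun w : E4 => (τ ^ 4)⁻¹ * K (τ⁻¹ • w)) ⋆[lsmul ℝ ℝ, volume] f) x = ∫ y, (τ ^ 4)⁻¹ * K (τ⁻¹ • (x - y)) * f y := by
  rw [convolution_lsmul_swap]
  rfl

/-- ★ **H4a with the kernel abstract and `kSmooth` unfolded.**  For a continuous compactly supported kernel `K` on `ℝ⁴` with
`∫ K = 1` and vanishing monomial moments of orders `1 … N−1` there is `C₁ ≥ 0` (namely `2∫|K|(1+‖v‖)^N`) such that for every smooth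
`f` supported in `B̄(c, ϱ)` with `‖D^m f‖ ≤ A/σ^m` (`m ≤ N`) and `0 < τ ≤ σ ≤ ϱ`:
`‖D^m(f − K_τ ⋆ f)(z)‖ ≤ C₁ (τ/σ)^N A/τ^m` for all `m ≤ N`. [folklore] -/
theorem molliApprox_core (K : E4 → ℝ) (hKc : Continuous K) (hK : HasCompactSupport K) (hK1 : ∫ v, K v = 1) {N : ℕ}
    (hmom : ∀ α : Fin 4 → ℕ, 1 ≤ ∑ i, α i → ∑ i, α i < N → ∫ y, K y * ∏ i, (y i) ^ (α i) = 0) :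
    ∃ C₁ : ℝ, 0 ≤ C₁ ∧
      ∀ (f : E4 → ℝ) (c : E4) (ϱ σ A τ : ℝ), ContDiff ℝ ∞ f → 0 < τ → τ ≤ σ → σ ≤ ϱ → 0 ≤ A →
        tsupport f ⊆ closedBall c ϱ →
        (∀ m : ℕ, m ≤ N → ∀ z, ‖iteratedFDeriv ℝ m f z‖ ≤ A / σ ^ m) →
        ∀ m : ℕ, m ≤ N → ∀ z,
          ‖iteratedFDeriv ℝ m (fun x => f x - ∫ y, (τ ^ 4)⁻¹ * K (τ⁻¹ • (x - y)) * f y) z‖ ≤ C₁ * (τ / σ) ^ N * A / τ ^ m := by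
  refine ⟨2 * ∫ v, |K v| * (1 + ‖v‖) ^ N, by positivity, ?_⟩
  intro f c ϱ σ A τ hf hτ hτσ _ _ hsupp hbd m hm z
  have hσ : 0 < σ := lt_of_lt_of_le hτ hτσ
  have hfc : HasCompactSupport f := (isCompact_closedBall c ϱ).of_isClosed_subset (isClosed_tsupport f) hsupp
  -- `f − K_τ ⋆ f = −(K_τ ⋆ f − f)`
  have hfun : (fun x => f x - ∫ y, (τ ^ 4)⁻¹ * K (τ⁻¹ • (x - y)) * f y) =
      -(((fun w : E4 => (τ ^ 4)⁻¹ * K (τ⁻¹ • w)) ⋆[lsmul ℝ ℝ, volume] f) - f) := by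
    funext x
    rw [Pi.neg_apply, Pi.sub_apply, convolution_scaled_apply, neg_sub]
  rw [hfun, iteratedFDeriv_neg_apply, norm_neg]
  have hNm : N - m + m = N := Nat.sub_add_cancel hm
  have hB : ∀ w, ‖iteratedFDeriv ℝ (N - m + m) f w‖ ≤ A / σ ^ N := fun w => by rw [hNm]; exact hbd N le_rfl w
  have h := norm_iteratedFDeriv_convolution_scaled_sub_self_le K hKc hK hK1 hmom hτ m hf hfc (Nat.sub_le N m) hB z
  refine h.trans (le_of_eq ?_)
  rw [pow_sub₀ τ hτ.ne' hm, div_pow]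
  field_simp

end Core

end Summit.QuantumFields.YangMills.Theorems.AtomicSynthesisMolli

end
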